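import Summits.AtomisticToContinuum.BoseEinsteinCondensation.Theorems.BlockLatticeFSumKinematics
import Summits.AtomisticToContinuum.BoseEinsteinCondensation.Theorems.BlockLatticeFSumWeightedPlancherel

/-!
# Lattice f-sum identity at the OCCUPATION level (route `BlockLatticeFSum`; decomp-a2c lens-6 g22)

`Σ_q ε(q)·n(f_q) = Σ_j Σ_B n(a_(B,j))` with the antisymmetric bond modes
`a_(B,j) = (u_B − u_(σ_j B))/√2` (`σ_j` = ANY successor map along axis `j`, spec `hσ`), for continuous
`(n+1)`-particle `Ψ`; per axis: `Σ_q (1 − cos(2πq_j/K))·n(f_q) = Σ_B n(a_(B,j))`.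
Ingredients: `WeightedPlancherel.weighted_plancherel` (Mathlib only) + the kinematics kit
(`modeAn_blockWave`, mode linearity, `cellOccupation_transfer_eq`). No definitions, no `sorry`.
This is the left-hand side of `ShellBudget` (stmt …-27507) in bond form.
-/

namespace Summit.AtomisticToContinuum.BoseEinsteinCondensation.Theses.BlockLatticeFSum.FSum

open MeasureTheory Complex
open scoped ENNReal NNReal ComplexConjugate BigOperators
open Literature.MathematicalPhysics.QuantumManyBody.BoseGas

variable {L : ℝ} {n K : ℕ}

/-- Amplitude of a bond mode: `a((u_B − u_B')/√2)Ψ(Y) = (a(u_B)Ψ(Y) − a(u_B')Ψ(Y))/√2`. -/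
theorem modeAn_bond (B B' : Fin 3 → Fin K) {Ψ : Config (n + 1) → ℂ} (hΨ : Continuous Ψ) (Y : Config n) :
    modeAn L (fun x : EuclideanSpace ℝ (Fin 3) => (((Real.sqrt 2)⁻¹ : ℝ) : ℂ) * ((if (∀ i : Fin 3, ⌊(K : ℝ) * x i / L⌋ = (((B i : Fin K) : ℕ) : ℤ)) then ((((Real.sqrt ((L / (K : ℝ)) ^ 3))⁻¹ : ℝ) : ℂ)) else 0) - (if (∀ i : Fin 3, ⌊(K : ℝ) * x i / L⌋ = (((B' i : Fin K) : ℕ) : ℤ)) then ((((Real.sqrt ((L / (K : ℝ)) ^ 3))⁻¹ : ℝ) : ℂ)) else 0))) Ψ Y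
      = (((Real.sqrt 2)⁻¹ : ℝ) : ℂ) * (modeAn L (fun x : EuclideanSpace ℝ (Fin 3) => if (∀ j : Fin 3, ⌊(K : ℝ) * x j / L⌋ = (((B j : Fin K) : ℕ) : ℤ)) then ((((Real.sqrt ((L / (K : ℝ)) ^ 3))⁻¹ : ℝ) : ℂ)) else 0) Ψ Y - modeAn L (fun x : EuclideanSpace ℝ (Fin 3) => if (∀ j : Fin 3, ⌊(K : ℝ) * x j / L⌋ = (((B' j : Fin K) : ℕ) : ℤ)) then ((((Real.sqrt ((L / (K : ℝ)) ^ 3))⁻¹ : ℝ) : ℂ)) else 0) Ψ Y) := by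
  rw [Kinematics.modeAn_const_mul_mode, Complex.conj_ofReal]
  congr 1
  exact Kinematics.modeAn_sub_mode (Kinematics.measurable_blockMode K L B) (Kinematics.measurable_blockMode K L B')
    (Kinematics.norm_blockMode_le K L B) (Kinematics.norm_blockMode_le K L B') hΨ Y

/-- Measurability of a bond mode. -/
theorem measurable_bond (B B' : Fin 3 → Fin K) : Measurable (fun x : EuclideanSpace ℝ (Fin 3) => (((Real.sqrt 2)⁻¹ : ℝ) : ℂ) * ((if (∀ i : Fin 3, ⌊(K : ℝ) * x i / L⌋ = (((B i : Fin K) : ℕ) : ℤ)) then ((((Real.sqrt ((L / (K : ℝ)) ^ 3))⁻¹ : ℝ) : ℂ)) else 0) - (if (∀ i : Fin 3, ⌊(K : ℝ) * x i / L⌋ = (((B' i : Fin K) : ℕ) : ℤ)) then ((((Real.sqrt ((L / (K : ℝ)) ^ 3))⁻¹ : ℝ) : ℂ)) else 0))) :=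
  measurable_const.mul ((Kinematics.measurable_blockMode K L B).sub (Kinematics.measurable_blockMode K L B'))

/-- Squared amplitude of a block wave: `‖a(f_q)Ψ(Y)‖² = ‖Σ_B conj(χ_q(B))·a(u_B)Ψ(Y)‖² / K³`. -/
theorem norm_sq_modeAn_blockWave (hK : 0 < K) (hL : 0 < L) (q : Fin 3 → Fin K)
    {Ψ : Config (n + 1) → ℂ} (hΨ : Continuous Ψ) (Y : Config n) :
    ‖modeAn L (fun x : EuclideanSpace ℝ (Fin 3) => (((Real.sqrt (L ^ 3))⁻¹ : ℝ) : ℂ) * Complex.exp (((2 * Real.pi * (∑ j : Fin 3, ((q j : ℕ) : ℝ) * (⌊(K : ℝ) * x j / L⌋ : ℝ)) / (K : ℝ) : ℝ) : ℂ) * Complex.I)) Ψ Y‖ ^ 2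
      = ‖∑ B : Fin 3 → Fin K, conj (Complex.exp (((2 * Real.pi * (∑ j : Fin 3, ((q j : ℕ) : ℝ) * ((B j : ℕ) : ℝ)) / (K : ℝ) : ℝ) : ℂ) * Complex.I)) * modeAn L (fun x : EuclideanSpace ℝ (Fin 3) => if (∀ j : Fin 3, ⌊(K : ℝ) * x j / L⌋ = (((B j : Fin K) : ℕ) : ℤ)) then ((((Real.sqrt ((L / (K : ℝ)) ^ 3))⁻¹ : ℝ) : ℂ)) else 0) Ψ Y‖ ^ 2 / (K : ℝ) ^ 3 := by
  rw [Kinematics.modeAn_blockWave hK hL q hΨ Y]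
  have hK3 : (0 : ℝ) < (K : ℝ) ^ 3 := by positivity
  have hc : ∀ B : Fin 3 → Fin K, conj (Complex.exp (((2 * Real.pi * (∑ j : Fin 3, ((q j : ℕ) : ℝ) * ((B j : ℕ) : ℝ)) / (K : ℝ) : ℝ) : ℂ) * Complex.I) / ((Real.sqrt ((K : ℝ) ^ 3) : ℝ) : ℂ)) * modeAn L (fun x : EuclideanSpace ℝ (Fin 3) => if (∀ j : Fin 3, ⌊(K : ℝ) * x j / L⌋ = (((B j : Fin K) : ℕ) : ℤ)) then ((((Real.sqrt ((L / (K : ℝ)) ^ 3))⁻¹ : ℝ) : ℂ)) else 0) Ψ Y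
      = (conj (Complex.exp (((2 * Real.pi * (∑ j : Fin 3, ((q j : ℕ) : ℝ) * ((B j : ℕ) : ℝ)) / (K : ℝ) : ℝ) : ℂ) * Complex.I)) * modeAn L (fun x : EuclideanSpace ℝ (Fin 3) => if (∀ j : Fin 3, ⌊(K : ℝ) * x j / L⌋ = (((B j : Fin K) : ℕ) : ℤ)) then ((((Real.sqrt ((L / (K : ℝ)) ^ 3))⁻¹ : ℝ) : ℂ)) else 0) Ψ Y) / ((Real.sqrt ((K : ℝ) ^ 3) : ℝ) : ℂ) := by
    intro B
    rw [map_div₀, Complex.conj_ofReal]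
    ring
  rw [Finset.sum_congr rfl fun B _ => hc B, ← Finset.sum_div, norm_div, div_pow, Complex.norm_real,
    Real.norm_of_nonneg (Real.sqrt_nonneg _), Real.sq_sqrt hK3.le]

/-- **f-SUM IDENTITY, ONE AXIS, occupation level.** -/
theorem fsum_occupation_axis (hK : 0 < K) (hL : 0 < L) (j : Fin 3)
    (σ : (Fin 3 → Fin K) → (Fin 3 → Fin K))
    (hσ : ∀ B : Fin 3 → Fin K, (∀ i : Fin 3, i ≠ j → σ B i = B i) ∧ ((σ B j : ℕ) = ((B j : ℕ) + 1) % K))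
    {Ψ : Config (n + 1) → ℂ} (hΨ : Continuous Ψ) :
    ∑ q : Fin 3 → Fin K, ENNReal.ofReal (1 - Real.cos (2 * Real.pi * ((q j : ℕ) : ℝ) / (K : ℝ))) * cellOccupation (n + 1) L (fun x : EuclideanSpace ℝ (Fin 3) => (((Real.sqrt (L ^ 3))⁻¹ : ℝ) : ℂ) * Complex.exp (((2 * Real.pi * (∑ j : Fin 3, ((q j : ℕ) : ℝ) * (⌊(K : ℝ) * x j / L⌋ : ℝ)) / (K : ℝ) : ℝ) : ℂ) * Complex.I)) Ψ
      = ∑ B : Fin 3 → Fin K, cellOccupation (n + 1) L (fun x : EuclideanSpace ℝ (Fin 3) => (((Real.sqrt 2)⁻¹ : ℝ) : ℂ) * ((if (∀ i : Fin 3, ⌊(K : ℝ) * x i / L⌋ = (((B i : Fin K) : ℕ) : ℤ)) then ((((Real.sqrt ((L / (K : ℝ)) ^ 3))⁻¹ : ℝ) : ℂ)) else 0) - (if (∀ i : Fin 3, ⌊(K : ℝ) * x i / L⌋ = ((((σ B) i : Fin K) : ℕ) : ℤ)) then ((((Real.sqrt ((L / (K : ℝ)) ^ 3))⁻¹ : ℝ)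 : ℂ)) else 0))) Ψ := by
  have h := Kinematics.cellOccupation_transfer_eq (L := L) (n := n) Finset.univ Finset.univ
    (fun q : Fin 3 → Fin K => (1 - Real.cos (2 * Real.pi * ((q j : ℕ) : ℝ) / (K : ℝ)))) (fun _ : Fin 3 → Fin K => (1 : ℝ))
    (fun q _ => sub_nonneg.2 (Real.cos_le_one _)) (fun _ _ => zero_le_one)
    (fun q : Fin 3 → Fin K => (fun x : EuclideanSpace ℝ (Fin 3) => (((Real.sqrt (L ^ 3))⁻¹ : ℝ) : ℂ) * Complex.exp (((2 * Real.pi * (∑ j : Fin 3, ((q j : ℕ) : ℝ) * (⌊(K : ℝ) * x j / L⌋ : ℝ)) / (K : ℝ) : ℝ) : ℂ) * Complex.I)))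
    (fun B : Fin 3 → Fin K => (fun x : EuclideanSpace ℝ (Fin 3) => (((Real.sqrt 2)⁻¹ : ℝ) : ℂ) * ((if (∀ i : Fin 3, ⌊(K : ℝ) * x i / L⌋ = (((B i : Fin K) : ℕ) : ℤ)) then ((((Real.sqrt ((L / (K : ℝ)) ^ 3))⁻¹ : ℝ) : ℂ)) else 0) - (if (∀ i : Fin 3, ⌊(K : ℝ) * x i / L⌋ = ((((σ B) i : Fin K) : ℕ) : ℤ)) then ((((Real.sqrt ((L / (K : ℝ)) ^ 3))⁻¹ : ℝ) : ℂ)) else 0))))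
    (fun q => Kinematics.measurable_blockWave K L q) (fun B => measurable_bond B (σ B)) hΨ ?_
  · simpa only [ENNReal.ofReal_one, one_mul] using h
  · intro Y _
    simp_rw [norm_sq_modeAn_blockWave hK hL _ hΨ Y, modeAn_bond _ _ hΨ Y, one_mul]
    simp_rw [mul_div_assoc']
    rw [← Finset.sum_div, WeightedPlancherel.weighted_plancherel hK j σ hσ]
    have hc2 : ∀ z : ℂ, ‖(((Real.sqrt 2)⁻¹ : ℝ) : ℂ) * z‖ ^ 2 = 2⁻¹ * ‖z‖ ^ 2 := by
      intro z
      rw [norm_mul, mul_pow, Complex.norm_real, Real.norm_of_nonneg (inv_nonneg.2 (Real.sqrt_nonneg _)),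
        inv_pow, Real.sq_sqrt (by norm_num : (0:ℝ) ≤ 2)]
    simp_rw [hc2]
    rw [← Finset.mul_sum]
    have hK3 : (K : ℝ) ^ 3 ≠ 0 := by positivity
    field_simp

/-- **f-SUM IDENTITY (all axes), occupation level** — the LHS of `ShellBudget` in bond form:
`Σ_q ε(q)·n(f_q) = Σ_j Σ_B n((u_B − u_(σ_j B))/√2)`. -/
theorem fsum_occupation (hK : 0 < K) (hL : 0 < L)
    (σ : Fin 3 → (Fin 3 → Fin K) → (Fin 3 → Fin K))
    (hσ : ∀ (j : Fin 3) (B : Fin 3 → Fin K),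
      (∀ i : Fin 3, i ≠ j → σ j B i = B i) ∧ ((σ j B j : ℕ) = ((B j : ℕ) + 1) % K))
    {Ψ : Config (n + 1) → ℂ} (hΨ : Continuous Ψ) :
    ∑ q : Fin 3 → Fin K, ENNReal.ofReal (∑ j : Fin 3, (1 - Real.cos (2 * Real.pi * ((q j : ℕ) : ℝ) / (K : ℝ)))) * cellOccupation (n + 1) L (fun x : EuclideanSpace ℝ (Fin 3) => (((Real.sqrt (L ^ 3))⁻¹ : ℝ) : ℂ) * Complex.exp (((2 * Real.pi * (∑ j : Fin 3, ((q j : ℕ) : ℝ) * (⌊(K : ℝ) * x j / L⌋ : ℝ)) / (K : ℝ) : ℝ) : ℂ) * Complex.I)) Ψ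
      = ∑ j : Fin 3, ∑ B : Fin 3 → Fin K, cellOccupation (n + 1) L (fun x : EuclideanSpace ℝ (Fin 3) => (((Real.sqrt 2)⁻¹ : ℝ) : ℂ) * ((if (∀ i : Fin 3, ⌊(K : ℝ) * x i / L⌋ = (((B i : Fin K) : ℕ) : ℤ)) then ((((Real.sqrt ((L / (K : ℝ)) ^ 3))⁻¹ : ℝ) : ℂ)) else 0) - (if (∀ i : Fin 3, ⌊(K : ℝ) * x i / L⌋ = ((((σ j B) i : Fin K) : ℕ) : ℤ)) then ((((Real.sqrt ((L / (K : ℝ)) ^ 3))⁻¹ : ℝ) : ℂ)) else 0))) Ψ := by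
  have hsplit : ∀ q : Fin 3 → Fin K, ENNReal.ofReal (∑ j : Fin 3, (1 - Real.cos (2 * Real.pi * ((q j : ℕ) : ℝ) / (K : ℝ))))
      = ∑ j : Fin 3, ENNReal.ofReal (1 - Real.cos (2 * Real.pi * ((q j : ℕ) : ℝ) / (K : ℝ))) := fun q =>
    ENNReal.ofReal_sum_of_nonneg fun j _ => sub_nonneg.2 (Real.cos_le_one _)
  simp_rw [hsplit, Finset.sum_mul]
  rw [Finset.sum_comm]
  exact Finset.sum_congr rfl fun j _ => fsum_occupation_axis hK hL j (σ j) (hσ j) hΨ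

end Summit.AtomisticToContinuum.BoseEinsteinCondensation.Theses.BlockLatticeFSum.FSum
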